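import Summits.Schanuel.Schanuel.Theorems.ZilberEacGraphCurveEscape
import HarnessLib

/-!
# Graph base × arbitrary curve, III: the lower-left edge of the support and the escaping
# exponential points of `P(e^z, e^{p(z)}) = 0`

HONEST FRAMING.  Cell `pub-schanuel` (Zilber's Exponential-Algebraic Closedness, case ladder;
host summit Schanuel), seat 2, gen 16.  Third file of the series proving Zariski density of the
exponential points of `{x₁ = p(x₀)} × Z(P)` (`ZilberEacGraphCurveDensity`), an instance class of
Mantova–Masser's OPEN density question (PLMS 2024, §1 p. 5).  NOT Schanuel's conjecture (neither
used nor implied; EAC ⇏ SC); `EC(3,2)` stays OPEN.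

THE MECHANISM (a Newton-polygon edge of `P` read through `y = (e^z, e^{p(z)})`).  Write
`P = Σ_{v ∈ A} c_v y₀^{v₀} y₁^{v₁}`, so that `P(e^z, e^{p(z)}) = Σ_v c_v e^{v₀ z + v₁ p(z)}`.
* Part A (`exists_lowerLeft_edge`, combinatorics of the finite support `A ⊆ ℕ²`): if `A` has two
  points with different `y₁`-exponents, there are a real slope `s` and a base point `v_b ∈ A` such
  that the weight `w(v) = v₀ - s v₁` is minimal at `v_b`, attains its minimum at a second point of
  `A`, and `v_b` has the least `y₁`-exponent among the minimisers (a vertex and an edge of the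
  lower-left Newton polygon; `s` is the slope tying the leftmost point to the point of least
  `|Δv₀/Δv₁|`).
* Part B (`eval_exp_eq_mul_edgeSum`): with `R₀ = p + s·X` and `M = {w = w(v_b)}`,
  `P(e^z, e^{p(z)}) = e^{v_{b,0} z + v_{b,1} p(z)} · (Q(e^{R₀(z)}) + E(z))`, where
  `Q(u) = Σ_{v ∈ M} c_v u^{v₁ - v_{b,1}}` has `Q(0) = c_{v_b} ≠ 0` and positive degree, and the
  off-edge part `E(z) = Σ_{v ∉ M} c_v e^{(w(v) - w(v_b)) z + (v₁ - v_{b,1}) R₀(z)}` satisfies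
  `‖E(z)‖ ≤ C_B e^{δ Re z}` for `Re z ≤ 0`, `|Re R₀(z)| ≤ B` (`δ` = the least positive weight gap).
* Part C (`exists_graphCurve_expPoints`): for `deg p ≥ 2` the engine
  `exists_escape_zeros` (`ZilberEacGraphCurveEscape`) gives zeros `z_k` of `P(e^z, e^{p(z)})`
  escaping in a left sector, `|Re z_k| / log(2 + ‖z_k‖) → ∞`.
-/

noncomputable section

open Filter Topology Metric Set Complex
open Literature.ModelTheory.Zilber

set_option linter.dupNamespace false

namespace Summit.Schanuel.Schanuel.Theorems

/-! ## Part A. The lower-left edge of a finite subset of `ℕ²` -/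

/-- **A lower-left edge of the Newton polygon.**  If the finite set `A ⊆ ℕ²` (exponent vectors on
`Fin 2`) has two points with different second coordinates, then for some real slope `s` and base
point `v_b ∈ A` the weight `w(v) = v₀ - s v₁` satisfies: `w(v_b) ≤ w(v)` on `A`; every minimiser
has second coordinate `≥` that of `v_b`; and some minimiser differs from `v_b`. (new) -/
theorem exists_lowerLeft_edge (A : Finset (Fin 2 →₀ ℕ))
    (h2 : ∃ v ∈ A, ∃ v' ∈ A, v 1 ≠ v' 1) :
    ∃ (s : ℝ) (vb : Fin 2 →₀ ℕ), vb ∈ A ∧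
      (∀ v ∈ A, ((vb 0 : ℝ) - s * vb 1) ≤ (v 0 : ℝ) - s * v 1) ∧
      (∀ v ∈ A, ((v 0 : ℝ) - s * v 1) = (vb 0 : ℝ) - s * vb 1 → vb 1 ≤ v 1) ∧
      (∃ v ∈ A, v ≠ vb ∧ ((v 0 : ℝ) - s * v 1) = (vb 0 : ℝ) - s * vb 1) := by
  classical
  obtain ⟨v₁, hv₁, v₁', hv₁', hne⟩ := h2
  have hA : A.Nonempty := ⟨v₁, hv₁⟩
  -- a point `v₀` with least first coordinate
  obtain ⟨v₀, hv₀, hmin0⟩ := A.exists_min_image (fun v => v 0) hA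
  -- the points off the horizontal line through `v₀`
  set T := A.filter (fun v : Fin 2 →₀ ℕ => v 1 ≠ v₀ 1) with hT
  have hTne : T.Nonempty := by
    by_cases h : v₁ 1 = v₀ 1
    · refine ⟨v₁', Finset.mem_filter.2 ⟨hv₁', ?_⟩⟩
      rw [← h]; exact fun h' => hne h'.symm
    · exact ⟨v₁, Finset.mem_filter.2 ⟨hv₁, h⟩⟩
  -- the point of `T` of least ratio `(v 0 - v₀ 0)/|v 1 - v₀ 1|`
  obtain ⟨vs, hvsT, hvsmin⟩ := T.exists_min_image
    (fun v => ((v 0 : ℝ) - v₀ 0) / |(v 1 : ℝ) - v₀ 1|) hTne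
  have hvsA : vs ∈ A := (Finset.mem_filter.1 hvsT).1
  have hvs1 : vs 1 ≠ v₀ 1 := (Finset.mem_filter.1 hvsT).2
  have hDs : ((vs 1 : ℝ) - v₀ 1) ≠ 0 := by
    intro h
    apply hvs1
    exact_mod_cast (sub_eq_zero.1 h)
  set s : ℝ := ((vs 0 : ℝ) - v₀ 0) / ((vs 1 : ℝ) - v₀ 1) with hs_def
  -- weight inequality on `A`
  have hw : ∀ v ∈ A, ((v₀ 0 : ℝ) - s * v₀ 1) ≤ (v 0 : ℝ) - s * v 1 := by
    intro v hv
    have hN : (v₀ 0 : ℝ) ≤ v 0 := by exact_mod_cast hmin0 v hv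
    by_cases h1 : v 1 = v₀ 1
    · rw [h1]; linarith
    · have hvT : v ∈ T := Finset.mem_filter.2 ⟨hv, h1⟩
      have hD : ((v 1 : ℝ) - v₀ 1) ≠ 0 := by
        intro h; apply h1; exact_mod_cast (sub_eq_zero.1 h)
      have hDpos : 0 < |(v 1 : ℝ) - v₀ 1| := abs_pos.2 hD
      have hDspos : 0 < |(vs 1 : ℝ) - v₀ 1| := abs_pos.2 hDs
      have hNs : (v₀ 0 : ℝ) ≤ vs 0 := by exact_mod_cast hmin0 vs hvsA
      have hr := hvsmin v hvT
      -- `s (v 1 - v₀ 1) ≤ |s| |v 1 - v₀ 1| = r(vs) |v 1 - v₀ 1| ≤ r(v) |v 1 - v₀ 1| = v 0 - v₀ 0`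
      have habs : |s| = ((vs 0 : ℝ) - v₀ 0) / |(vs 1 : ℝ) - v₀ 1| := by
        rw [hs_def, abs_div, abs_of_nonneg (by linarith)]
      have h3 : s * ((v 1 : ℝ) - v₀ 1) ≤ (v 0 : ℝ) - v₀ 0 := by
        calc s * ((v 1 : ℝ) - v₀ 1) ≤ |s * ((v 1 : ℝ) - v₀ 1)| := le_abs_self _
          _ = ((vs 0 : ℝ) - v₀ 0) / |(vs 1 : ℝ) - v₀ 1| * |(v 1 : ℝ) - v₀ 1| := by
              rw [abs_mul, habs]
          _ ≤ ((v 0 : ℝ) - v₀ 0) / |(v 1 : ℝ) - v₀ 1| * |(v 1 : ℝ) - v₀ 1| :=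
              mul_le_mul_of_nonneg_right hr hDpos.le
          _ = (v 0 : ℝ) - v₀ 0 := div_mul_cancel₀ _ hDpos.ne'
      linarith
  -- `vs` is a second minimiser
  have hws : ((vs 0 : ℝ) - s * vs 1) = (v₀ 0 : ℝ) - s * v₀ 1 := by
    have : s * ((vs 1 : ℝ) - v₀ 1) = (vs 0 : ℝ) - v₀ 0 := by
      rw [hs_def]; exact div_mul_cancel₀ _ hDs
    linarith
  -- the minimisers and the one of least second coordinate
  set M := A.filter (fun v : Fin 2 →₀ ℕ => ((v 0 : ℝ) - s * v 1) = (v₀ 0 : ℝ) - s * v₀ 1) with hM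
  have hv₀M : v₀ ∈ M := Finset.mem_filter.2 ⟨hv₀, rfl⟩
  have hvsM : vs ∈ M := Finset.mem_filter.2 ⟨hvsA, hws⟩
  obtain ⟨vb, hvbM, hvbmin⟩ := M.exists_min_image (fun v => v 1) ⟨v₀, hv₀M⟩
  have hvbA : vb ∈ A := (Finset.mem_filter.1 hvbM).1
  have hwb : ((vb 0 : ℝ) - s * vb 1) = (v₀ 0 : ℝ) - s * v₀ 1 := (Finset.mem_filter.1 hvbM).2
  refine ⟨s, vb, hvbA, fun v hv => ?_, fun v hv hvw => ?_, ?_⟩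
  · rw [hwb]; exact hw v hv
  · exact hvbmin v (Finset.mem_filter.2 ⟨hv, by rw [hvw, hwb]⟩)
  · -- one of `v₀ ≠ vs` differs from `vb`
    have hne0 : vs ≠ v₀ := fun h => hvs1 (by rw [h])
    by_cases hb : vs = vb
    · refine ⟨v₀, hv₀, ?_, by rw [hwb]⟩
      rw [← hb]; exact fun h => hne0 h.symm
    · exact ⟨vs, hvsA, hb, by rw [hws, hwb]⟩

/-- Two points of equal weight and equal second coordinate coincide. -/
theorem gce_eq_of_weight_eq {s : ℝ} {v v' : Fin 2 →₀ ℕ}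
    (hw : ((v 0 : ℝ) - s * v 1) = (v' 0 : ℝ) - s * v' 1) (h1 : v 1 = v' 1) : v = v' := by
  have h0 : (v 0 : ℝ) = v' 0 := by rw [h1] at hw; linarith
  have h0' : v 0 = v' 0 := by exact_mod_cast h0
  ext i
  fin_cases i
  · exact h0'
  · exact h1

/-! ## Part B. The exponential sum along the graph and its edge decomposition -/

section EdgeSum

variable (p : Polynomial ℂ) (P : MvPolynomial (Fin 2) ℂ)

/-- `P(e^z, e^{p(z)}) = Σ_{v ∈ supp P} c_v e^{v₀ z + v₁ p(z)}`. -/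
theorem eval_exp_eq_sum (z : ℂ) :
    MvPolynomial.eval ![exp z, exp (p.eval z)] P =
      ∑ v ∈ P.support, P.coeff v * exp ((v 0 : ℂ) * z + (v 1 : ℂ) * p.eval z) := by
  rw [MvPolynomial.eval_eq']
  refine Finset.sum_congr rfl fun v _ => ?_
  simp only [Fin.prod_univ_two, Matrix.cons_val_zero, Matrix.cons_val_one,
    Matrix.cons_val_fin_one, Complex.exp_add, Complex.exp_nat_mul]

variable {p P} {s : ℝ} {vb : Fin 2 →₀ ℕ}

/-- **Edge decomposition.**  With `R₀ = p + sX`, `M = {v ∈ supp P : w(v) = w(v_b)}`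
(`w(v) = v₀ - s v₁`) and `v_{b,1} ≤ v₁` on `M`:
`P(e^z, e^{p(z)}) = e^{v_{b,0} z + v_{b,1} p(z)} · (Q(e^{R₀(z)}) + E(z))`,
`Q = Σ_{v ∈ M} c_v X^{v₁ - v_{b,1}}`, `E(z) = Σ_{v ∉ M} c_v e^{(w(v)-w(v_b)) z + (v₁ - v_{b,1}) R₀(z)}`.
(new) -/
theorem eval_exp_eq_mul_edgeSum
    (hE2 : ∀ v ∈ P.support, ((v 0 : ℝ) - s * v 1) = (vb 0 : ℝ) - s * vb 1 → vb 1 ≤ v 1)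
    (z : ℂ) :
    MvPolynomial.eval ![exp z, exp (p.eval z)] P =
      exp ((vb 0 : ℂ) * z + (vb 1 : ℂ) * p.eval z) *
        ((∑ v ∈ P.support.filter (fun v : Fin 2 →₀ ℕ => ((v 0 : ℝ) - s * v 1) = (vb 0 : ℝ) - s * vb 1),
            Polynomial.C (P.coeff v) * Polynomial.X ^ (v 1 - vb 1)).eval
            (exp ((p + Polynomial.C (s : ℂ) * Polynomial.X).eval z)) +
          ∑ v ∈ P.support.filter (fun v : Fin 2 →₀ ℕ => ¬ ((v 0 : ℝ) - s * v 1) = (vb 0 : ℝ) - s * vb 1),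
            P.coeff v * exp ((((v 0 : ℝ) - s * v 1 - ((vb 0 : ℝ) - s * vb 1) : ℝ) : ℂ) * z +
              (((v 1 : ℝ) - vb 1 : ℝ) : ℂ) * (p + Polynomial.C (s : ℂ) * Polynomial.X).eval z)) := by
  classical
  rw [eval_exp_eq_sum, Polynomial.eval_finsetSum, mul_add, Finset.mul_sum, Finset.mul_sum,
    ← Finset.sum_filter_add_sum_filter_not P.support
      (fun v : Fin 2 →₀ ℕ => ((v 0 : ℝ) - s * v 1) = (vb 0 : ℝ) - s * vb 1)]
  have hR : (p + Polynomial.C (s : ℂ) * Polynomial.X).eval z = p.eval z + (s : ℂ) * z := by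
    simp [Polynomial.eval_add, Polynomial.eval_mul]
  congr 1
  · refine Finset.sum_congr rfl fun v hv => ?_
    obtain ⟨hvA, hvw⟩ := Finset.mem_filter.1 hv
    have hle : vb 1 ≤ v 1 := hE2 v hvA hvw
    have hwC := congrArg (fun r : ℝ => (r : ℂ)) hvw
    push_cast at hwC
    rw [Polynomial.eval_mul, Polynomial.eval_C, Polynomial.eval_pow, Polynomial.eval_X,
      ← Complex.exp_nat_mul, Nat.cast_sub hle, hR, mul_left_comm, ← Complex.exp_add]
    congr 2
    linear_combination z * hwC
  · refine Finset.sum_congr rfl fun v _ => ?_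
    rw [hR, mul_left_comm, ← Complex.exp_add]
    congr 2
    push_cast
    ring

/-- The value `Q(0)` of the edge polynomial is the coefficient of the base point. -/
theorem eval_zero_edgePoly (hvb : vb ∈ P.support)
    (hE2 : ∀ v ∈ P.support, ((v 0 : ℝ) - s * v 1) = (vb 0 : ℝ) - s * vb 1 → vb 1 ≤ v 1) :
    (∑ v ∈ P.support.filter (fun v : Fin 2 →₀ ℕ => ((v 0 : ℝ) - s * v 1) = (vb 0 : ℝ) - s * vb 1),
        Polynomial.C (P.coeff v) * Polynomial.X ^ (v 1 - vb 1)).eval 0 = P.coeff vb := by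
  classical
  rw [Polynomial.eval_finsetSum]
  rw [Finset.sum_eq_single vb]
  · simp
  · intro v hv hne
    obtain ⟨hvA, hvw⟩ := Finset.mem_filter.1 hv
    have hlt : vb 1 < v 1 := by
      rcases (hE2 v hvA hvw).lt_or_eq with h | h
      · exact h
      · exact absurd (gce_eq_of_weight_eq hvw h.symm) hne
    have hpos : v 1 - vb 1 ≠ 0 := by omega
    simp [zero_pow hpos]
  · intro h
    exact (h (Finset.mem_filter.2 ⟨hvb, rfl⟩)).elim

/-- The edge polynomial has positive degree as soon as the edge has a second point. -/
theorem natDegree_edgePoly_pos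
    (hE2 : ∀ v ∈ P.support, ((v 0 : ℝ) - s * v 1) = (vb 0 : ℝ) - s * vb 1 → vb 1 ≤ v 1)
    (hE3 : ∃ v ∈ P.support, v ≠ vb ∧ ((v 0 : ℝ) - s * v 1) = (vb 0 : ℝ) - s * vb 1) :
    0 < (∑ v ∈ P.support.filter (fun v : Fin 2 →₀ ℕ => ((v 0 : ℝ) - s * v 1) = (vb 0 : ℝ) - s * vb 1),
        Polynomial.C (P.coeff v) * Polynomial.X ^ (v 1 - vb 1)).natDegree := by
  classical
  obtain ⟨vs, hvsA, hne, hws⟩ := hE3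
  have hlt : vb 1 < vs 1 := by
    rcases (hE2 vs hvsA hws).lt_or_eq with h | h
    · exact h
    · exact absurd (gce_eq_of_weight_eq hws h.symm) hne
  have hn : 0 < vs 1 - vb 1 := by omega
  refine lt_of_lt_of_le hn (Polynomial.le_natDegree_of_ne_zero ?_)
  rw [Polynomial.finsetSum_coeff, Finset.sum_eq_single vs]
  · simpa using MvPolynomial.mem_support_iff.1 hvsA
  · intro v hv hvne
    obtain ⟨hvA, hvw⟩ := Finset.mem_filter.1 hv
    rw [Polynomial.coeff_C_mul, Polynomial.coeff_X_pow, if_neg, mul_zero]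
    intro h
    have hle := hE2 v hvA hvw
    have h1 : v 1 = vs 1 := by omega
    exact hvne (gce_eq_of_weight_eq (hvw.trans hws.symm) h1)
  · intro h
    exact (h (Finset.mem_filter.2 ⟨hvsA, hws⟩)).elim

/-- **The off-edge part is exponentially small in the escape regime**: if `δ > 0` is at most every
positive weight gap, then for `Re z ≤ 0` and `|Re R₀(z)| ≤ B`,
`‖E(z)‖ ≤ (Σ_{v ∉ M} ‖c_v‖ e^{|v₁ - v_{b,1}| B}) · e^{δ Re z}`. (new) -/
theorem norm_offEdgeSum_le {δ B : ℝ}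
    (hδ : ∀ v ∈ P.support, ¬ ((v 0 : ℝ) - s * v 1) = (vb 0 : ℝ) - s * vb 1 →
      δ ≤ ((v 0 : ℝ) - s * v 1) - ((vb 0 : ℝ) - s * vb 1))
    {z : ℂ} (hz : z.re ≤ 0)
    (hB : |((p + Polynomial.C (s : ℂ) * Polynomial.X).eval z).re| ≤ B) :
    ‖∑ v ∈ P.support.filter (fun v : Fin 2 →₀ ℕ => ¬ ((v 0 : ℝ) - s * v 1) = (vb 0 : ℝ) - s * vb 1),
        P.coeff v * exp ((((v 0 : ℝ) - s * v 1 - ((vb 0 : ℝ) - s * vb 1) : ℝ) : ℂ) * z +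
          (((v 1 : ℝ) - vb 1 : ℝ) : ℂ) * (p + Polynomial.C (s : ℂ) * Polynomial.X).eval z)‖ ≤
      (∑ v ∈ P.support.filter (fun v : Fin 2 →₀ ℕ => ¬ ((v 0 : ℝ) - s * v 1) = (vb 0 : ℝ) - s * vb 1),
          ‖P.coeff v‖ * Real.exp (|(v 1 : ℝ) - vb 1| * B)) * Real.exp (δ * z.re) := by
  classical
  rw [Finset.sum_mul]
  refine (norm_sum_le _ _).trans (Finset.sum_le_sum fun v hv => ?_)
  obtain ⟨hvA, hvw⟩ := Finset.mem_filter.1 hv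
  rw [norm_mul, Complex.norm_exp, Complex.add_re, Complex.re_ofReal_mul, Complex.re_ofReal_mul,
    mul_assoc, ← Real.exp_add]
  refine mul_le_mul_of_nonneg_left (Real.exp_le_exp.2 ?_) (norm_nonneg _)
  have h1 : ((v 0 : ℝ) - s * v 1 - ((vb 0 : ℝ) - s * vb 1)) * z.re ≤ δ * z.re :=
    mul_le_mul_of_nonpos_right (hδ v hvA hvw) hz
  have h2 : ((v 1 : ℝ) - vb 1) * ((p + Polynomial.C (s : ℂ) * Polynomial.X).eval z).re ≤
      |(v 1 : ℝ) - vb 1| * B := by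
    refine (le_abs_self _).trans ?_
    rw [abs_mul]
    exact mul_le_mul_of_nonneg_left hB (abs_nonneg _)
  linarith

/-- The off-edge part is entire. -/
theorem differentiable_offEdgeSum :
    Differentiable ℂ fun z : ℂ =>
      ∑ v ∈ P.support.filter (fun v : Fin 2 →₀ ℕ => ¬ ((v 0 : ℝ) - s * v 1) = (vb 0 : ℝ) - s * vb 1),
        P.coeff v * exp ((((v 0 : ℝ) - s * v 1 - ((vb 0 : ℝ) - s * vb 1) : ℝ) : ℂ) * z +
          (((v 1 : ℝ) - vb 1 : ℝ) : ℂ) * (p + Polynomial.C (s : ℂ) * Polynomial.X).eval z) := by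
  refine Differentiable.fun_sum fun v _ => ?_
  refine (differentiable_const _).mul ?_
  refine (((differentiable_const _).mul differentiable_id).add
    ((differentiable_const _).mul (Polynomial.differentiable _))).cexp

end EdgeSum

/-! ## Part C. Escaping exponential points of `{x₁ = p(x₀)} × Z(P)` -/

/-- **Escaping zeros of `P(e^z, e^{p(z)})`.**  Let `deg p ≥ 2` and let `P ∈ ℂ[y₀, y₁]` have two
monomials with different `y₁`-exponents.  Then there are `z_k` with `P(e^{z_k}, e^{p(z_k)}) = 0`
and `|Re z_k| / log(2 + ‖z_k‖) → ∞` (in fact `Re z_k → -∞` linearly in `‖z_k‖`). (new) -/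
theorem exists_graphCurve_expPoints (p : Polynomial ℂ) (hd : 2 ≤ p.natDegree)
    (P : MvPolynomial (Fin 2) ℂ) (h2 : ∃ v ∈ P.support, ∃ v' ∈ P.support, v 1 ≠ v' 1) :
    ∃ z : ℕ → ℂ, (∀ k, MvPolynomial.eval ![exp (z k), exp (p.eval (z k))] P = 0) ∧
      Tendsto (fun k => |(z k).re| / Real.log (2 + ‖z k‖)) atTop atTop := by
  classical
  obtain ⟨s, vb, hvb, hE1, hE2, hE3⟩ := exists_lowerLeft_edge P.support h2
  -- the polynomial `R₀ = p + sX` has the degree of `p`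
  set R₀ : Polynomial ℂ := p + Polynomial.C (s : ℂ) * Polynomial.X with hR₀
  have hdeg : R₀.natDegree = p.natDegree := by
    rw [hR₀]
    apply Polynomial.natDegree_add_eq_left_of_natDegree_lt
    calc (Polynomial.C (s : ℂ) * Polynomial.X).natDegree ≤ Polynomial.X.natDegree :=
          Polynomial.natDegree_C_mul_le _ _
      _ ≤ 1 := Polynomial.natDegree_X_le
      _ < p.natDegree := by omega
  have hdR : 2 ≤ R₀.natDegree := by rw [hdeg]; exact hd
  -- the edge polynomial
  set Q : Polynomial ℂ := ∑ v ∈ P.support.filter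
      (fun v : Fin 2 →₀ ℕ => ((v 0 : ℝ) - s * v 1) = (vb 0 : ℝ) - s * vb 1),
    Polynomial.C (P.coeff v) * Polynomial.X ^ (v 1 - vb 1) with hQ
  have hQ0 : Q.eval 0 ≠ 0 := by
    rw [hQ, eval_zero_edgePoly hvb hE2]
    exact MvPolynomial.mem_support_iff.1 hvb
  have hQd : 0 < Q.natDegree := natDegree_edgePoly_pos hE2 hE3
  -- the off-edge part and its weight gap `δ`
  set N := P.support.filter (fun v : Fin 2 →₀ ℕ => ¬ ((v 0 : ℝ) - s * v 1) = (vb 0 : ℝ) - s * vb 1) with hN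
  obtain ⟨δ, hδpos, hδ⟩ : ∃ δ : ℝ, 0 < δ ∧ ∀ v ∈ P.support,
      ¬ ((v 0 : ℝ) - s * v 1) = (vb 0 : ℝ) - s * vb 1 →
        δ ≤ ((v 0 : ℝ) - s * v 1) - ((vb 0 : ℝ) - s * vb 1) := by
    by_cases hNe : N.Nonempty
    · obtain ⟨vm, hvm, hvmmin⟩ := N.exists_min_image
        (fun v => ((v 0 : ℝ) - s * v 1) - ((vb 0 : ℝ) - s * vb 1)) hNe
      obtain ⟨hvmA, hvmw⟩ := Finset.mem_filter.1 hvm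
      refine ⟨((vm 0 : ℝ) - s * vm 1) - ((vb 0 : ℝ) - s * vb 1), ?_, fun v hv hvw =>
        hvmmin v (Finset.mem_filter.2 ⟨hv, hvw⟩)⟩
      have := hE1 vm hvmA
      rcases this.lt_or_eq with h | h
      · linarith
      · exact absurd h.symm hvmw
    · refine ⟨1, zero_lt_one, fun v hv hvw => ?_⟩
      exact absurd ⟨v, Finset.mem_filter.2 ⟨hv, hvw⟩⟩ hNe
  set E : ℂ → ℂ := fun z => ∑ v ∈ N,
    P.coeff v * exp ((((v 0 : ℝ) - s * v 1 - ((vb 0 : ℝ) - s * vb 1) : ℝ) : ℂ) * z +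
      (((v 1 : ℝ) - vb 1 : ℝ) : ℂ) * R₀.eval z) with hEdef
  have hEdiff : Differentiable ℂ E := differentiable_offEdgeSum
  have hEb : ∀ B : ℝ, ∃ C : ℝ, 0 ≤ C ∧
      ∀ z : ℂ, z.re ≤ 0 → |(R₀.eval z).re| ≤ B → ‖E z‖ ≤ C * Real.exp (δ * z.re) := by
    intro B
    refine ⟨∑ v ∈ N, ‖P.coeff v‖ * Real.exp (|(v 1 : ℝ) - vb 1| * B),
      Finset.sum_nonneg fun v _ => by positivity, fun z hz hzB => ?_⟩
    exact norm_offEdgeSum_le hδ hz hzB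
  -- the engine
  obtain ⟨z, L, hL, hz⟩ := exists_escape_zeros R₀ Q hdR hQ0 hQd E hEdiff hδpos hEb
  refine ⟨z, fun k => ?_, tendsto_abs_re_div_log_of_linear hL (fun k => (hz k).2.1)
    (fun k => (hz k).2.2)⟩
  rw [eval_exp_eq_mul_edgeSum hE2 (z k)]
  have h := (hz k).1
  rw [hQ, hEdef] at h
  rw [h, mul_zero]

end Summit.Schanuel.Schanuel.Theorems
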